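import Summits.QuantumFields.YangMills.Theorems.BalabanUVNodesN15CurvedGluingSmoothCutDressedGluedAdjointTrueDefect
import Summits.QuantumFields.YangMills.Theorems.BalabanUVNodesN15CurvedGluingSmoothCutDressedGluedAdjointGauged
import HarnessLib

/-!
# ENTRY 2 `𝒢∘∇⁻_ν` OF THE LIVE GLUED PROPAGATOR IN THE GLOBAL GAUGE, ONE GRID, FOR **ANY RIGHT INVERSE** `Y` OF THE GLOBAL OPERATOR — FILE 158 ★★ fed by the dressed smooth-cut cubes' rows
# (file 34, FILE 153 ★, FILE 167 ★) and the identification FILE 167 ★★ (`𝒵 = Y`): `Y∘∇⁻_ν` decays, the operand LITERALLY the node's `cvGlued∘∇⁻_ν` once instantiated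
# (dag-n15-c g19, FILE 168; N15 = NE2, s1 road (c) — the typed home of FLAG №13's located burden)

Cell `pub-ymgap`, seat `pub-ymgap-dag-n15-c` (R134 (a); HUMAN RULING D-0062), generation 19.  `bears_on: R4∕N15 · K3⁸ SpineGivenEndpointR13SepCoPHV (stmt-QuantumFields-27366)`.
Filed `--kind proof --supports stmt-QuantumFields-27366 --as helper` — COUNT-NEUTRAL.  Theorems only; 0 `def`, 0 `sorry`.  Imports BY NAME FILE 167 `…SmoothCutDressedGluedAdjointTrueDefect`
(★ `hasMaj_smoothCutDressed_comp_commOp_global`, ★★ `glued_adjoint_eq_rightInverse`; through it FILE 158 `hasMaj_glueInvL_parametrix_comp_cut_of_defect_out`, FILE 153 `smoothCutDressed_comp_grad_sandwich` ∕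
`comp_mulOp_of_sandwich` ∕ `hasMaj_adjRightEntry_loc₂`, file 34 `hasMaj_smoothCutDressed_loc₂` ∕ `mulOp_comp_smoothCutDressed`, FILE 163 §1 `mulOp_fst_comp_bgrad_leib`, FILE 148 `isUnit_neumannR`).
Nothing in the tree is modified; nothing restated.

WHY.  FILE 167 ★★ identifies the adjoint resummation `𝒵` of the dressed smooth-cut cubes (true right-locality defects `Ẽ_k` displayed) with ANY right inverse `Y` of the global operator `Δ`; FILE 158 ★★
bounds `𝒵∘E` for a right factor `E` with a scalar adjoint Leibniz rule.  THIS FILE puts them together for `E := ∇⁻_ν` (g18 FINDING (ix): the pure gradient is glued, the transport of `∇^{U*}_μ` is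
appended afterwards by FILE 159): per cube the cut row of `X_k` (file 34), the sandwiched adjoint right entry `M_{χ_k}Ñ_{𝒲_k}M_{χ̃_k}T⁻_ν` through the `ν`-shifted partition function (FILE 153), its
row (FILE 153 ★), the adjoint remainder row against the global operator (FILE 167 ★), the defect rows; then `𝒵 = Y`.  The conclusion mentions ONLY `Y∘∇⁻_ν` — at the cover LITERALLY
`cvGlued … 1 U N_L 0 ∘ ∇⁻_ν` once `Y := cvGlued` and `Δ∘cvGlued = 1` (FILE 133) are supplied: no glued term, no gauge sandwich in the statement.

WHAT.  ★★★ `hasMaj_rightInverse_bgrad_smoothCutDressed`: FILE 167's data plus the direction `ν`, the `ν`-shifted support `h_k∘e_ν ≠ 0 ⟹ χ_k = 1`, `|χ_k| ≤ 1`, `Δ∘Y = 1` ⟹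
`Y∘∇⁻_ν ≤ (1 − N_ov(Θ′ + ε_E)c_r)⁻¹·N_ov(β^X·1 + B̄′c₁)·c_r·e^{−(ρ₃−2σ)d}`, `Θ′ = Θ₁₅₃ + B̄′θ_Fc_r`, `β^X = (1 − θ_𝒲c_r)⁻¹β^Qc_r`, `B̄′ = β̄(1 − β̄Rc_r²)⁻¹`, `β̄ = β + (β₁ + c̃β)`.

HONEST FRAMING ∕ LIMITS.  Composition of LANDED theorems over DISPLAYED rows — the operator-level content of entry 2 of (3.42) in the global small-field gauge as a CONDITIONAL statement on King's ∕
dag-n15-a's model carriers; proves NO estimate of a concrete propagator; nothing of [B5]∕[B6]∕[B9] asserted ((2.91)–(2.93) p.239, (2.133)–(2.136) p.247, (3.42) p.397, (3.52) p.400, (3.62)–(3.65)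
pp.402–403, (3.76)–(3.77) pp.405–406 = SHAPES ∕ MECHANISM).  NE2 for non-abelian `G(U)` NOT proved (C-N15-1); N15 booked «discharged AS CONSUMED at the U-blind v7 pin» (№253) — this file is
road (c)'s bookkeeping and moves NO count; K3⁸ skeleton untouched; one finite 𝕋⁴ at fixed ε — NOT infinite volume, NOT OS on ℝ⁴, NOT a mass gap, NOT Clay.  Restate-immune (no Theses import).
-/

set_option autoImplicit false

noncomputable section
open scoped BigOperators Matrix
open Finset

namespace Summit.QuantumFields.YangMills.BalabanUVNodes.N15.Gluing

open Literature.MathematicalPhysics.QuantumFieldTheory.Balaban1983to89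
open Literature.MathematicalPhysics.QuantumFieldTheory.Balaban1983to89.B11SectG (BlockNorm HasMaj RowSum hasMaj_zero)
open Literature.MathematicalPhysics.QuantumFieldTheory.Balaban1983to89.B6RandomWalk (Triangle254)
open Literature.MathematicalPhysics.QuantumFieldTheory.Balaban1983to89.T4EtaRateCoeffDefect (diagK diagK_nonneg hasMaj_mulOp)
open Literature.MathematicalPhysics.QuantumFieldTheory.Balaban1983to89.B6Prop26Gluing (mulOp mulOp_apply ind ind_nonneg ind_le_one)
open Summit.QuantumFields.YangMills.BalabanUVNodes.N15.MatrixSpecies (mmulOp liftBlk liftEquiv liftEquiv_apply liftEquiv_symm_apply)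
open Summit.QuantumFields.YangMills.BalabanUVNodes.N15.BackgroundLayer (fgrad bgrad fgradAdj fgrad_apply bgrad_apply stack projO unstackM bgPropV blkPair)
open Summit.QuantumFields.YangMills.BalabanUVNodes.N15.CurvedSpecies (hasMaj_smoothCutDressed_loc₂ mulOp_comp_smoothCutDressed hasMaj_smoothCut_flat hasMaj_jet_smoothCut_flat smoothCut_out
  hasMaj_dressedV_pair)


/-! ## Entry 2 for any right inverse of the global operator -/

section Capstone

variable {X ι J K : Type} [Fintype X] [DecidableEq X] [Fintype ι] [DecidableEq ι] [Fintype J] [DecidableEq J] [Fintype K] {g : B6.Geometry} (blk : X → g.Site) (τ : J → X ≃ X) (n : ℝ) (ν : J)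
  {σ cr : ℝ} {N : K → (X × ι → ℝ) →ₗ[ℝ] (X × ι → ℝ)} {Cc : K → X → Matrix ι ι ℝ} {Ac : K → J ⊕ J → X → Matrix ι ι ℝ}
  {NVc Ed F : K → (X × ι → ℝ) →ₗ[ℝ] (X × ι → ℝ)} {Δ NL Yop : (X × ι → ℝ) →ₗ[ℝ] (X × ι → ℝ)} {χX χtX ψX ψ₂X hX : K → X → ℝ} {Sk : K → Set g.Site}
  {hb : K → g.Site → ℝ} {Tf Tb : K → J → (X × ι → ℝ) →ₗ[ℝ] (X × ι → ℝ)}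

set_option maxHeartbeats 800000 in
/-- ★★★ **ENTRY 2 `Y∘∇⁻_ν` FOR ANY RIGHT INVERSE `Y` OF THE GLOBAL OPERATOR, FROM THE DRESSED SMOOTH-CUT CUBES GLUED ADJOINTLY WITH THEIR TRUE RIGHT-LOCALITY DEFECTS** (global gauge, `W = 0`).
Per cube `k`: file 34's cube data (cut rows `β, β₁` of `N_k`, bump letters∕insertions, input cuts, `V̂_k = unstackM C_k A_k + N_{V,k}∘pr₀ ≤ Re^{−δ_Vd}`, `β̄Rc_r² < 1`), the adjoint letter `𝒲_k ≤ θ_𝒲e^{−δ_Wd}`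
(`θ_𝒲c_r < 1`), the flat sandwiches `N_k∘∇^±_μ∘M_{χ_k} = T^±∘M_{χ_k}` (rows `β^Q`, input cuts `ψ₂`), the partition (`|h| ≤ 1`, `Σ_kh_k² = 1`, `M_hM_χ = M_h`, letters `c₀, c₁, c₂`, block reading `ℓ, ω`,
transition layers and the `ν`-shifted support inside `{χ_k = 1}`), species rows `r_A`, `[N_L, M_h] ≤ c_Ne^{−ρ_Nd}`, base rows `R_N`, overlap `N_ov`; the split `Δ = (Δ₀ + N_L − V̂_k∘jet) + F_k`
with the far commutator row `X_k∘[F_k, M_{h_k}] ≤ 1_S(y)θ_Fe^{−ρ₃d}`; the TRUE right-locality defects `X_k∘Δ∘M_{h_k} = M_{h_k} + Ẽ_k`, `Ẽ_k ≤ 1_S1_S·ε_Ee^{−ρ₃d}`; a right inverse `Δ∘Y = 1`;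
rates as in FILE 153 with `2σ ≤ ρ₃`; ONE smallness.  Then `Y∘∇⁻_ν ≤ (1 − N_ov(Θ′ + ε_E)c_r)⁻¹·N_ov(β^X·1 + B̄′c₁)·c_r·e^{−(ρ₃−2σ)d}` — the operand is LITERALLY the node's `cvGlued∘∇⁻_ν` once
instantiated. [cite: Balaban1985BackgroundPropagators, (3.42) p.397 (entry `G∇*_U`), (3.52) p.400, (3.62)–(3.65) pp.402–403, (3.76)–(3.77) pp.405–406, (3.87) p.409; Balaban1984PropagatorsI, (1.120)–(1.128) pp.37–39; Balaban1984PropagatorsII, (2.91)–(2.93) p.239, (2.133)–(2.136) p.247 (shapes + mechanism, transposed)] -/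
theorem hasMaj_rightInverse_bgrad_smoothCutDressed (htri : Triangle254 g) (hd : ∀ a b : g.Site, 0 ≤ g.dist a b) (hsymm : ∀ y y', g.dist y y' = g.dist y' y) (hd0 : ∀ y : g.Site, g.dist y y = 0) (hrow : RowSum g σ cr) (hσ : 0 ≤ σ)
    {ρ₁ ρ₂ ρ₃ ρN δV δN δW ε R c₀ c₁ c₂ cN rA RN ℓ ω β β₁ ct δ βQ θA θF εE Nov : ℝ} (hβ : 0 ≤ β) (hβ₁ : 0 ≤ β₁) (hβQ : 0 ≤ βQ) (hct : 0 ≤ ct) (hR : 0 ≤ R) (hcr : 0 ≤ cr) (hc₀ : 0 ≤ c₀)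
    (hc₁ : 0 ≤ c₁) (hc₂ : 0 ≤ c₂) (hcN : 0 ≤ cN) (hrA : 0 ≤ rA) (hRN : 0 ≤ RN) (hℓ : 0 ≤ ℓ) (hω : 0 ≤ ω) (hθA : 0 ≤ θA) (hθF : 0 ≤ θF) (hεE : 0 ≤ εE) (hNov : 0 ≤ Nov) (hε : 0 < ε) (hσρ : σ ≤ ρ₁)
    (hρ₁V : ρ₁ ≤ δV) (hρ₁G : ρ₁ + σ ≤ δ) (hρ₂ : 0 ≤ ρ₂) (hρ₂₁ : ρ₂ + σ ≤ ρ₁) (hρ₃ : 0 ≤ ρ₃) (hρ₃N : ρ₃ ≤ ρN) (hρ₃V : ρ₃ ≤ δN - ε) (hρ₃₂ : ρ₃ + σ ≤ ρ₂) (hρ₂W : ρ₂ + 2 * σ ≤ δW)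
    (hσρ₃ : 2 * σ ≤ ρ₃)
    -- per cube: cuts (supports over `S_k`, bump letters and insertions, input cuts)
    (hSχ : ∀ k x, χX k x ≠ 0 → blk x ∈ Sk k) (hSψ : ∀ k x, ψX k x ≠ 0 → blk x ∈ Sk k) (hSψ₂ : ∀ k x, ψ₂X k x ≠ 0 → blk x ∈ Sk k) (hχt : ∀ k x, |χtX k x| ≤ 1) (hχ1 : ∀ k x, |χX k x| ≤ 1)
    (hdχt : ∀ k μ p, |fgrad n (liftEquiv (τ μ) ι) (fun p : X × ι => χtX k p.1) p| ≤ ct) (hdχtb : ∀ k μ p, |bgrad n (liftEquiv (τ μ) ι) (fun p : X × ι => χtX k p.1) p| ≤ ct)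
    (hsub : ∀ k, mulOp (fun p : X × ι => χtX k p.1) ∘ₗ mulOp (fun p : X × ι => χX k p.1) = mulOp (fun p : X × ι => χtX k p.1))
    (hχ : ∀ k, mulOp (fun p : X × ι => χX k p.1) ∘ₗ mulOp (fun p : X × ι => χtX k p.1) = mulOp (fun p : X × ι => χtX k p.1))
    (hs : ∀ k μ, mulOp ((fun p : X × ι => χtX k p.1) ∘ (liftEquiv (τ μ) ι)) ∘ₗ mulOp (fun p : X × ι => χX k p.1) = mulOp ((fun p : X × ι => χtX k p.1) ∘ (liftEquiv (τ μ) ι)))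
    (hsb : ∀ k μ, mulOp ((fun p : X × ι => χtX k p.1) ∘ (liftEquiv (τ μ) ι).symm) ∘ₗ mulOp (fun p : X × ι => χX k p.1) = mulOp ((fun p : X × ι => χtX k p.1) ∘ (liftEquiv (τ μ) ι).symm))
    (hdd : ∀ k μ, mulOp (fgrad n (liftEquiv (τ μ) ι) (fun p : X × ι => χtX k p.1)) ∘ₗ mulOp (fun p : X × ι => χX k p.1) = mulOp (fgrad n (liftEquiv (τ μ) ι) (fun p : X × ι => χtX k p.1)))
    (hddb : ∀ k μ, mulOp (bgrad n (liftEquiv (τ μ) ι) (fun p : X × ι => χtX k p.1)) ∘ₗ mulOp (fun p : X × ι => χX k p.1) = mulOp (bgrad n (liftEquiv (τ μ) ι) (fun p : X × ι => χtX k p.1)))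
    (hNψ : ∀ k, N k ∘ₗ mulOp (fun p : X × ι => ψX k p.1) = N k)
    -- per cube: the flat cube's cut rows, SANDWICHED right entries with rows and input cuts
    (hcut : ∀ k, HasMaj (BlockNorm.ofBlocks g (liftBlk blk ι)) (BlockNorm.ofBlocks g (liftBlk blk ι)) (mulOp (fun p : X × ι => χX k p.1) ∘ₗ N k) (fun y y' => ind (Sk k) y * ind (Sk k) y' * (β * Real.exp (-(δ * g.dist y y')))))
    (hcutF : ∀ k μ, HasMaj (BlockNorm.ofBlocks g (liftBlk blk ι)) (BlockNorm.ofBlocks g (liftBlk blk ι)) (mulOp (fun p : X × ι => χX k p.1) ∘ₗ (fgrad n (liftEquiv (τ μ) ι) ∘ₗ N k)) (fun y y' => ind (Sk k) y * ind (Sk k) y' * (β₁ * Real.exp (-(δ * g.dist y y')))))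
    (hcutB : ∀ k μ, HasMaj (BlockNorm.ofBlocks g (liftBlk blk ι)) (BlockNorm.ofBlocks g (liftBlk blk ι)) (mulOp (fun p : X × ι => χX k p.1) ∘ₗ (bgrad n (liftEquiv (τ μ) ι) ∘ₗ N k)) (fun y y' => ind (Sk k) y * ind (Sk k) y' * (β₁ * Real.exp (-(δ * g.dist y y')))))
    (hTf : ∀ k μ, N k ∘ₗ fgrad n (liftEquiv (τ μ) ι) ∘ₗ mulOp (fun p : X × ι => χX k p.1) = Tf k μ ∘ₗ mulOp (fun p : X × ι => χX k p.1))
    (hTb : ∀ k μ, N k ∘ₗ bgrad n (liftEquiv (τ μ) ι) ∘ₗ mulOp (fun p : X × ι => χX k p.1) = Tb k μ ∘ₗ mulOp (fun p : X × ι => χX k p.1))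
    (hTfr : ∀ k μ, HasMaj (BlockNorm.ofBlocks g (liftBlk blk ι)) (BlockNorm.ofBlocks g (liftBlk blk ι)) (Tf k μ) (fun y y' => ind (Sk k) y * ind (Sk k) y' * (βQ * Real.exp (-(δW * g.dist y y')))))
    (hTbr : ∀ k μ, HasMaj (BlockNorm.ofBlocks g (liftBlk blk ι)) (BlockNorm.ofBlocks g (liftBlk blk ι)) (Tb k μ) (fun y y' => ind (Sk k) y * ind (Sk k) y' * (βQ * Real.exp (-(δW * g.dist y y')))))
    (hTfψ : ∀ k μ, Tf k μ ∘ₗ mulOp (fun p : X × ι => ψ₂X k p.1) = Tf k μ) (hTbψ : ∀ k μ, Tb k μ ∘ₗ mulOp (fun p : X × ι => ψ₂X k p.1) = Tb k μ)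
    -- per cube: the cut perturbation's letter, smallness, the adjoint letter of `𝒲_k`
    (hV : ∀ k, HasMaj (BlockNorm.ofBlocks g (blkPair (liftBlk blk ι))) (BlockNorm.ofBlocks g (liftBlk blk ι)) (unstackM (Cc k) (Ac k) + NVc k ∘ₗ projO (none : Option (J ⊕ J))) (fun y y' => R * Real.exp (-(δV * g.dist y y'))))
    (hq : (β + (β₁ + ct * β)) * (R * cr) * cr < 1)
    (hW𝒲 : ∀ k, HasMaj (BlockNorm.ofBlocks g (liftBlk blk ι)) (BlockNorm.ofBlocks g (liftBlk blk ι))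
      ((mulOp (fun p : X × ι => χtX k p.1) ∘ₗ N k) ∘ₗ (unstackM (Cc k) (Ac k) + NVc k ∘ₗ projO (none : Option (J ⊕ J))) ∘ₗ
        stack LinearMap.id (fun j => Sum.elim (fun μ => fgrad n (liftEquiv (τ μ) ι)) (fun μ => bgrad n (liftEquiv (τ μ) ι)) j) ∘ₗ mulOp (fun p : X × ι => χX k p.1))
      (fun y y' => θA * Real.exp (-(δW * g.dist y y'))))
    (hqA : θA * cr < 1)
    -- per cube: the partition, its supports inside `ψ_k`, `χ_k` and its transition layers inside the cut (also shifted by `e_ν`); the partition of unity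
    (hhabs : ∀ k x, |hX k x| ≤ 1)
    (hhcut : ∀ k, mulOp (fun p : X × ι => hX k p.1) ∘ₗ mulOp (fun p : X × ι => χX k p.1) = mulOp (fun p : X × ι => hX k p.1))
    (hh1 : ∀ k μ x, |fgrad n (τ μ) (hX k) x| ≤ c₁) (hh1b : ∀ k μ x, |bgrad n (τ μ) (hX k) x| ≤ c₁) (hh0 : ∀ k μ x, |hX k (τ μ x) - hX k x| ≤ c₀)
    (hLip : ∀ k y y', |hb k y - hb k y'| ≤ ℓ * g.dist y y') (hrh : ∀ k x, |hX k x - hb k (blk x)| ≤ ω)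
    (hh2 : ∀ k μ p, |fgradAdj n (liftEquiv (τ μ) ι) (fgrad n (liftEquiv (τ μ) ι) (fun p : X × ι => hX k p.1)) p| ≤ c₂)
    (hh2f : ∀ k μ p, |fgrad n (liftEquiv (τ μ) ι) (fgrad n (liftEquiv (τ μ) ι) (fun p : X × ι => hX k p.1)) p| ≤ c₂)
    (hh2b : ∀ k μ p, |bgrad n (liftEquiv (τ μ) ι) (bgrad n (liftEquiv (τ μ) ι) (fun p : X × ι => hX k p.1) ∘ ⇑(liftEquiv (τ μ) ι)) p| ≤ c₂)
    (hlayf : ∀ k μ x, hX k x ≠ hX k ((τ μ).symm x) → χX k x = 1) (hlayb : ∀ k μ x, hX k (τ μ x) ≠ hX k x → χX k x = 1) (hlayν : ∀ k x, hX k (τ ν x) ≠ 0 → χX k x = 1)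
    (h236 : ∀ p : X × ι, ∑ k, (fun p : X × ι => hX k p.1) p ^ 2 = 1)
    -- per cube: species rows of the cut coefficients, the flat nonlocal commutator letter, base part; overlap
    (hA : ∀ k j x i, ∑ l, |Ac k j x i l| ≤ rA)
    (hKN : ∀ k, HasMaj (BlockNorm.ofBlocks g (liftBlk blk ι)) (BlockNorm.ofBlocks g (liftBlk blk ι)) (commOp NL (fun p : X × ι => hX k p.1)) (fun y y' => cN * Real.exp (-(ρN * g.dist y y'))))
    (hNV : ∀ k, HasMaj (BlockNorm.ofBlocks g (liftBlk blk ι)) (BlockNorm.ofBlocks g (liftBlk blk ι)) (NVc k) (fun y y' => RN * Real.exp (-(δN * g.dist y y'))))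
    (hN : ∀ a, ∑ k, ind (Sk k) a ≤ Nov)
    -- THE GLOBAL OPERATOR read in cube `k` = the cube's model operator + a far defect `F_k`; its adjoint commutator row; the TRUE right-locality defect and its row; a right inverse
    (hcov : ∀ k, Δ = (lapOp n (fun μ => liftEquiv (τ μ) ι) 0 + NL - (unstackM (Cc k) (Ac k) + NVc k ∘ₗ projO (none : Option (J ⊕ J))) ∘ₗ
      stack LinearMap.id (fun j => Sum.elim (fun μ => fgrad n (liftEquiv (τ μ) ι)) (fun μ => bgrad n (liftEquiv (τ μ) ι)) j)) + F k)
    (hFK : ∀ k, HasMaj (BlockNorm.ofBlocks g (liftBlk blk ι)) (BlockNorm.ofBlocks g (liftBlk blk ι)) ((projO none ∘ₗ bgPropV (stack (mulOp (fun p : X × ι => χtX k p.1) ∘ₗ N k) (fun j => Sum.elim (fun μ => fgrad n (liftEquiv (τ μ) ι)) (fun μ => bgrad n (liftEquiv (τ μ) ι)) j ∘ₗ (mulOp (fun p : X × ι => χtX k p.1) ∘ₗ N k))) (unstackM (Cc k) (Ac k) + NVc k ∘ₗ projO (none : Option (J ⊕ J)))) ∘ₗ commOp (F k) (fun p : X ×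 ι => hX k p.1))
      (fun y y' => ind (Sk k) y * (θF * Real.exp (-(ρ₃ * g.dist y y')))))
    (hloc : ∀ k, (projO none ∘ₗ bgPropV (stack (mulOp (fun p : X × ι => χtX k p.1) ∘ₗ N k) (fun j => Sum.elim (fun μ => fgrad n (liftEquiv (τ μ) ι)) (fun μ => bgrad n (liftEquiv (τ μ) ι)) j ∘ₗ (mulOp (fun p : X × ι => χtX k p.1) ∘ₗ N k))) (unstackM (Cc k) (Ac k) + NVc k ∘ₗ projO (none : Option (J ⊕ J)))) ∘ₗ Δ ∘ₗ mulOp (fun p : X × ι => hX k p.1) =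
      mulOp (fun p : X × ι => hX k p.1) + Ed k)
    (hEd : ∀ k, HasMaj (BlockNorm.ofBlocks g (liftBlk blk ι)) (BlockNorm.ofBlocks g (liftBlk blk ι)) (Ed k) (fun y y' => ind (Sk k) y * ind (Sk k) y' * (εE * Real.exp (-(ρ₃ * g.dist y y')))))
    (hqL : Nov * ((((((Fintype.card J : ℝ) * (3 * ((β + (β₁ + ct * β)) * (1 - (β + (β₁ + ct * β)) * (R * cr) * cr)⁻¹ * c₂) + 2 * (((1 - θA * cr)⁻¹ * βQ * cr) * c₁)) + 0)
          + (β + (β₁ + ct * β)) * (1 - (β + (β₁ + ct * β)) * (R * cr) * cr)⁻¹ * cN * cr)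
        + (((Fintype.card J : ℝ) * (2 * rA * (c₁ * ((β + (β₁ + ct * β)) * (1 - (β + (β₁ + ct * β)) * (R * cr) * cr)⁻¹) + c₀ * ((1 - θA * cr)⁻¹ * βQ * cr))))
          + (β + (β₁ + ct * β)) * (1 - (β + (β₁ + ct * β)) * (R * cr) * cr)⁻¹ * ((ℓ * (Real.exp 1 * ε)⁻¹ + 2 * ω) * RN) * cr)) + θF) + εE) * cr < 1) (hY : Δ ∘ₗ Yop = LinearMap.id) :
    HasMaj (BlockNorm.ofBlocks g (liftBlk blk ι)) (BlockNorm.ofBlocks g (liftBlk blk ι)) (Yop ∘ₗ bgrad n (liftEquiv (τ ν) ι))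
      (fun y y' => (1 - Nov * ((((((Fintype.card J : ℝ) * (3 * ((β + (β₁ + ct * β)) * (1 - (β + (β₁ + ct * β)) * (R * cr) * cr)⁻¹ * c₂) + 2 * (((1 - θA * cr)⁻¹ * βQ * cr) * c₁)) + 0)
          + (β + (β₁ + ct * β)) * (1 - (β + (β₁ + ct * β)) * (R * cr) * cr)⁻¹ * cN * cr)
        + (((Fintype.card J : ℝ) * (2 * rA * (c₁ * ((β + (β₁ + ct * β)) * (1 - (β + (β₁ + ct * β)) * (R * cr) * cr)⁻¹) + c₀ * ((1 - θA * cr)⁻¹ * βQ * cr))))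
          + (β + (β₁ + ct * β)) * (1 - (β + (β₁ + ct * β)) * (R * cr) * cr)⁻¹ * ((ℓ * (Real.exp 1 * ε)⁻¹ + 2 * ω) * RN) * cr)) + θF) + εE) * cr)⁻¹ *
        (Nov * (((1 - θA * cr)⁻¹ * βQ * cr) * 1 + ((β + (β₁ + ct * β)) * (1 - (β + (β₁ + ct * β)) * (R * cr) * cr)⁻¹) * c₁)) * cr * Real.exp (-((ρ₃ - 2 * σ) * g.dist y y'))) := by
  have hβb : 0 ≤ β + (β₁ + ct * β) := by positivity
  have hB : 0 ≤ ((β + (β₁ + ct * β)) * (1 - (β + (β₁ + ct * β)) * (R * cr) * cr)⁻¹) := mul_nonneg hβb (inv_nonneg.2 (by linarith))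
  have hinv : 0 ≤ (1 - θA * cr)⁻¹ := inv_nonneg.2 (by linarith)
  have hBX : 0 ≤ ((1 - θA * cr)⁻¹ * βQ * cr) := mul_nonneg (mul_nonneg hinv hβQ) hcr
  have hΘ : 0 ≤ ((((Fintype.card J : ℝ) * (3 * ((β + (β₁ + ct * β)) * (1 - (β + (β₁ + ct * β)) * (R * cr) * cr)⁻¹ * c₂) + 2 * (((1 - θA * cr)⁻¹ * βQ * cr) * c₁)) + 0)
          + (β + (β₁ + ct * β)) * (1 - (β + (β₁ + ct * β)) * (R * cr) * cr)⁻¹ * cN * cr)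
        + (((Fintype.card J : ℝ) * (2 * rA * (c₁ * ((β + (β₁ + ct * β)) * (1 - (β + (β₁ + ct * β)) * (R * cr) * cr)⁻¹) + c₀ * ((1 - θA * cr)⁻¹ * βQ * cr))))
          + (β + (β₁ + ct * β)) * (1 - (β + (β₁ + ct * β)) * (R * cr) * cr)⁻¹ * ((ℓ * (Real.exp 1 * ε)⁻¹ + 2 * ω) * RN) * cr)) := by positivity
  have hΘF : 0 ≤ ((((Fintype.card J : ℝ) * (3 * ((β + (β₁ + ct * β)) * (1 - (β + (β₁ + ct * β)) * (R * cr) * cr)⁻¹ * c₂) + 2 * (((1 - θA * cr)⁻¹ * βQ * cr) * c₁)) + 0)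
          + (β + (β₁ + ct * β)) * (1 - (β + (β₁ + ct * β)) * (R * cr) * cr)⁻¹ * cN * cr)
        + (((Fintype.card J : ℝ) * (2 * rA * (c₁ * ((β + (β₁ + ct * β)) * (1 - (β + (β₁ + ct * β)) * (R * cr) * cr)⁻¹) + c₀ * ((1 - θA * cr)⁻¹ * βQ * cr))))
          + (β + (β₁ + ct * β)) * (1 - (β + (β₁ + ct * β)) * (R * cr) * cr)⁻¹ * ((ℓ * (Real.exp 1 * ε)⁻¹ + 2 * ω) * RN) * cr)) + θF := add_nonneg hΘ hθF
  have h2σ : 2 * σ ≤ δW := by linarith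
  -- the units, per cube
  have hGf := fun k => hasMaj_smoothCut_flat blk (S := Sk k) hβ hβ₁ hct (hχt k) (hsub k) (hcut k)
  have hDf := fun k => hasMaj_jet_smoothCut_flat blk τ n (S := Sk k) hβ hβ₁ hct (hχt k) (hdχt k) (hdχtb k) (hs k) (hsb k) (hdd k) (hddb k) (hcut k) (hcutF k) (hcutB k)
  have hunit := fun k => (hasMaj_dressedV_pair blk htri hd hrow hσ hβb hR hcr hσρ hρ₁V hρ₁G hρ₂ hρ₂₁ (hGf k) (hDf k) (hV k) hq).1
  have hunitW := fun k => isUnit_neumannR (liftBlk blk ι) hd hrow hθA (by linarith) (hW𝒲 k) hqA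
  have hDj : ∀ k, ∀ j, (fun j => Sum.elim (fun μ => fgrad n (liftEquiv (τ μ) ι)) (fun μ => bgrad n (liftEquiv (τ μ) ι)) j ∘ₗ (mulOp (fun p : X × ι => χtX k p.1) ∘ₗ N k)) j = (fun j => Sum.elim (fun μ => fgrad n (liftEquiv (τ μ) ι)) (fun μ => bgrad n (liftEquiv (τ μ) ι)) j) j ∘ₗ (mulOp (fun p : X × ι => χtX k p.1) ∘ₗ N k) := fun _ _ => rfl
  have rate : ∀ (T : Set g.Site) {c ρ' : ℝ}, 0 ≤ c → ρ₃ ≤ ρ' → ∀ y y' : g.Site,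
      ind T y * ind T y' * (c * Real.exp (-(ρ' * g.dist y y'))) ≤ ind T y * ind T y' * (c * Real.exp (-(ρ₃ * g.dist y y'))) :=
    fun T c ρ' hc hρ y y' => mul_le_mul_of_nonneg_left (exp_rate_mono hd hc hρ y y') (mul_nonneg (ind_nonneg _ _) (ind_nonneg _ _))
  -- (1) each dressed cube's two-sided row (file 34) and its cut row (`M_χX = X`), weakened to the rate `ρ₃`
  have hXr : ∀ k, HasMaj (BlockNorm.ofBlocks g (liftBlk blk ι)) (BlockNorm.ofBlocks g (liftBlk blk ι)) (projO none ∘ₗ bgPropV (stack (mulOp (fun p : X × ι => χtX k p.1) ∘ₗ N k) (fun j => Sum.elim (fun μ => fgrad n (liftEquiv (τ μ) ι)) (fun μ => bgrad n (liftEquiv (τ μ) ι)) j ∘ₗ (mulOp (fun p : X × ι => χtX k p.1) ∘ₗ N k))) (unstackM (Cc k) (Ac k) + NVc k ∘ₗ projO (none : Option (J ⊕ J)))) (fun y y' => ind (Sk k) y * ind (Sk k) y' * (((β + (β₁ + ct * β)) * (1 - (β + (β₁ + ct * β)) * (R * cr) * cr)⁻¹) * Real.exp (-(ρ₃ * g.dist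 y y')))) := fun k =>
    (hasMaj_smoothCutDressed_loc₂ blk τ n htri hd hrow hσ hβ hβ₁ hct hR hcr hσρ hρ₁V hρ₁G hρ₂ hρ₂₁ (hSχ k) (hSψ k) (hχt k) (hdχt k) (hdχtb k) (hsub k) (hχ k) (hs k)
      (hsb k) (hdd k) (hddb k) (hNψ k) (hcut k) (hcutF k) (hcutB k) (hV k) hq).mono (rate (Sk k) hB (by linarith))
  have hGc : ∀ k, HasMaj (BlockNorm.ofBlocks g (liftBlk blk ι)) (BlockNorm.ofBlocks g (liftBlk blk ι)) (mulOp (fun p : X × ι => χX k p.1) ∘ₗ (projO none ∘ₗ bgPropV (stack (mulOp (fun p : X × ι => χtX k p.1) ∘ₗ N k) (fun j => Sum.elim (fun μ => fgrad n (liftEquiv (τ μ) ι)) (fun μ => bgrad n (liftEquiv (τ μ) ι)) j ∘ₗ (mulOp (fun p : X × ι => χtX k p.1) ∘ₗ N k))) (unstackM (Cc k) (Ac k) + NVc k ∘ₗ projO (none : Option (J ⊕ J))))) (fun y y' => ind (Sk k) y * ind (Sk k) y' * (((β + (β₁ + ct * β)) * (1 - (β + (β₁ + ct * β)) * (R * cr)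 * cr)⁻¹) * Real.exp (-(ρ₃ * g.dist y y')))) := fun k => by
    rw [mulOp_comp_smoothCutDressed τ n (hχ k) (hNψ k) (hunit k)]
    exact hXr k
  -- (2) the sandwiched adjoint right entry `T^X_k = Ñ_𝒲∘M_χ̃∘T⁻_ν`, its row (FILE 153 ★) cut by `M_χ`, at the rate `ρ₃`
  have hWχ : ∀ k, mulOp (fun p : X × ι => χX k p.1) ∘ₗ ((mulOp (fun p : X × ι => χtX k p.1) ∘ₗ N k) ∘ₗ (unstackM (Cc k) (Ac k) + NVc k ∘ₗ projO (none : Option (J ⊕ J))) ∘ₗ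
        stack LinearMap.id (fun j => Sum.elim (fun μ => fgrad n (liftEquiv (τ μ) ι)) (fun μ => bgrad n (liftEquiv (τ μ) ι)) j) ∘ₗ mulOp (fun p : X × ι => χX k p.1)) =
      ((mulOp (fun p : X × ι => χtX k p.1) ∘ₗ N k) ∘ₗ (unstackM (Cc k) (Ac k) + NVc k ∘ₗ projO (none : Option (J ⊕ J))) ∘ₗ
        stack LinearMap.id (fun j => Sum.elim (fun μ => fgrad n (liftEquiv (τ μ) ι)) (fun μ => bgrad n (liftEquiv (τ μ) ι)) j) ∘ₗ mulOp (fun p : X × ι => χX k p.1)) := fun k => by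
    simp only [← LinearMap.comp_assoc]
    rw [hχ k]
  have hT2 : ∀ k, HasMaj (BlockNorm.ofBlocks g (liftBlk blk ι)) (BlockNorm.ofBlocks g (liftBlk blk ι)) (mulOp (fun p : X × ι => χX k p.1) ∘ₗ (neumannR ((mulOp (fun p : X × ι => χtX k p.1) ∘ₗ N k) ∘ₗ (unstackM (Cc k) (Ac k) + NVc k ∘ₗ projO (none : Option (J ⊕ J))) ∘ₗ
        stack LinearMap.id (fun j => Sum.elim (fun μ => fgrad n (liftEquiv (τ μ) ι)) (fun μ => bgrad n (liftEquiv (τ μ) ι)) j) ∘ₗ mulOp (fun p : X × ι => χX k p.1)) ∘ₗ (mulOp (fun p : X × ι => χtX k p.1) ∘ₗ Tb k ν))) (fun y y' => ind (Sk k) y * ind (Sk k) y' * (((1 - θA * cr)⁻¹ * βQ * cr) * Real.exp (-(ρ₃ * g.dist y y')))) := fun k =>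
    (hasMaj_diag_comp (liftBlk blk ι) (fun _ => zero_le_one) (hasMaj_mulOp (g := g) (liftBlk blk ι) (m := fun _ => (1 : ℝ)) (fun _ => zero_le_one) (fun p : X × ι => hχ1 k p.1))
      ((hasMaj_adjRightEntry_loc₂ blk htri hd hd0 hrow hσ hcr (hSχ k) (hSψ₂ k) (hχt k) (hWχ k) (hχ k) (hTbψ k ν) hβQ hθA h2σ (hW𝒲 k) (hTbr k ν) hqA).mono
      (rate (Sk k) hBX (by linarith)))).mono fun y y' => le_of_eq (one_mul _)
  -- (3) the sandwich against `∇⁻_ν` through the `ν`-shifted partition function (FILE 153)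
  have hE2 : ∀ k, mulOp (fun p : X × ι => χX k p.1) ∘ₗ (projO none ∘ₗ bgPropV (stack (mulOp (fun p : X × ι => χtX k p.1) ∘ₗ N k) (fun j => Sum.elim (fun μ => fgrad n (liftEquiv (τ μ) ι)) (fun μ => bgrad n (liftEquiv (τ μ) ι)) j ∘ₗ (mulOp (fun p : X × ι => χtX k p.1) ∘ₗ N k))) (unstackM (Cc k) (Ac k) + NVc k ∘ₗ projO (none : Option (J ⊕ J)))) ∘ₗ bgrad n (liftEquiv (τ ν) ι) ∘ₗ mulOp (fun p : X × ι => hX k (τ ν p.1)) =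
      (mulOp (fun p : X × ι => χX k p.1) ∘ₗ (neumannR ((mulOp (fun p : X × ι => χtX k p.1) ∘ₗ N k) ∘ₗ (unstackM (Cc k) (Ac k) + NVc k ∘ₗ projO (none : Option (J ⊕ J))) ∘ₗ
        stack LinearMap.id (fun j => Sum.elim (fun μ => fgrad n (liftEquiv (τ μ) ι)) (fun μ => bgrad n (liftEquiv (τ μ) ι)) j) ∘ₗ mulOp (fun p : X × ι => χX k p.1)) ∘ₗ (mulOp (fun p : X × ι => χtX k p.1) ∘ₗ Tb k ν))) ∘ₗ mulOp (fun p : X × ι => hX k (τ ν p.1)) := fun k => by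
    have hsand := smoothCutDressed_comp_grad_sandwich τ n (hDj k) (hunit k) (hχ k) (hunitW k) (Q := bgrad n (liftEquiv (τ ν) ι)) (hTb k ν)
    have ha := comp_mulOp_of_sandwich (a := fun p : X × ι => hX k (τ ν p.1)) hsand (fun p hp => hlayν k p.1 hp)
    rw [ha, ← LinearMap.comp_assoc]
  -- (4) the adjoint remainder row against the global operator (FILE 167 ★)
  have hK := hasMaj_smoothCutDressed_comp_commOp_global blk τ n htri hd hsymm hd0 hrow hσ hβ hβ₁ hβQ hct hR hcr hc₀ hc₁ hc₂ hcN hrA hRN hℓ hω hθA hε hσρ hρ₁V hρ₁G hρ₂ hρ₂₁ hρ₃ hρ₃N hρ₃V hρ₃₂ hρ₂W hSχ hSψ hSψ₂ hχt hdχt hdχtb hsub hχ hs hsb hdd hddb hNψ hcut hcutF hcutB hTf hTb hTfr hTbr hTfψ hTbψ hV hq hW𝒲 hqA hh1 hh1b hh0 hLip hrh hh2 hh2f hh2b hlayf hlayb hA hKN hNV hcov hFK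
  -- (5) the scalar adjoint Leibniz rule of `∇⁻_ν`
  have hleib : ∀ k, mulOp (fun p : X × ι => hX k p.1) ∘ₗ bgrad n (liftEquiv (τ ν) ι) =
      bgrad n (liftEquiv (τ ν) ι) ∘ₗ mulOp (fun p : X × ι => hX k (τ ν p.1)) + mulOp (fun p : X × ι => -(fgrad n (τ ν) (hX k) p.1)) := fun k =>
    mulOp_fst_comp_bgrad_leib n (τ ν) (hX k)
  have hβ2 : 0 ≤ ((1 - θA * cr)⁻¹ * βQ * cr) := hBX
  -- FILE 158 ★★: the bound for the adjoint glued operator with the true defects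
  have hZ := hasMaj_glueInvL_parametrix_comp_cut_of_defect_out (liftBlk blk ι) Sk htri hd hd0 hrow hσ (E := bgrad n (liftEquiv (τ ν) ι)) (h := fun k => fun p : X × ι => hX k p.1)
    (hs := fun k => fun p : X × ι => hX k (τ ν p.1)) (dh := fun k => fun p : X × ι => -(fgrad n (τ ν) (hX k) p.1)) (χ := fun k => fun p : X × ι => χX k p.1)
    (G := fun k => projO none ∘ₗ bgPropV (stack (mulOp (fun p : X × ι => χtX k p.1) ∘ₗ N k) (fun j => Sum.elim (fun μ => fgrad n (liftEquiv (τ μ) ι)) (fun μ => bgrad n (liftEquiv (τ μ) ι)) j ∘ₗ (mulOp (fun p : X × ι => χtX k p.1) ∘ₗ N k))) (unstackM (Cc k) (Ac k) + NVc k ∘ₗ projO (none : Option (J ⊕ J))))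
    (T₂ := fun k => mulOp (fun p : X × ι => χX k p.1) ∘ₗ (neumannR ((mulOp (fun p : X × ι => χtX k p.1) ∘ₗ N k) ∘ₗ (unstackM (Cc k) (Ac k) + NVc k ∘ₗ projO (none : Option (J ⊕ J))) ∘ₗ
        stack LinearMap.id (fun j => Sum.elim (fun μ => fgrad n (liftEquiv (τ μ) ι)) (fun μ => bgrad n (liftEquiv (τ μ) ι)) j) ∘ₗ mulOp (fun p : X × ι => χX k p.1)) ∘ₗ (mulOp (fun p : X × ι => χtX k p.1) ∘ₗ Tb k ν)))
    (Ed := Ed) hB hβ2 zero_le_one hc₁ hΘF hεE hNov hσρ₃ hleib hhcut hE2 (fun k p => hhabs k p.1) (fun k p => hhabs k (τ ν p.1)) (fun k p => by rw [abs_neg]; exact hh1 k ν p.1) hN hGc hT2 hK hEd hqL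
  -- FILE 167 ★★: the adjoint glued operator with the true defects is the right inverse `Y`
  rw [glued_adjoint_eq_rightInverse blk τ n htri hd hsymm hd0 hrow hσ hβ hβ₁ hβQ hct hR hcr hc₀ hc₁ hc₂ hcN hrA hRN hℓ hω hθA hθF hεE hNov hε hσρ hρ₁V hρ₁G hρ₂ hρ₂₁ hρ₃ hρ₃N hρ₃V hρ₃₂ hρ₂W hσρ₃ hSχ hSψ hSψ₂ hχt hdχt hdχtb hsub hχ hs hsb hdd hddb hNψ hcut hcutF hcutB hTf hTb hTfr hTbr hTfψ hTbψ hV hq hW𝒲 hqA hhabs hh1 hh1b hh0 hLip hrh hh2 hh2f hh2b hlayf hlayb h236 hA hKN hNV hN hcov hFK hloc hEd hqL hY] at hZ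
  exact hZ

end Capstone

end Summit.QuantumFields.YangMills.BalabanUVNodes.N15.Gluing

end
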